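import Mathlib
import Literature.Probability.RandomPlanarGeometry.ChordalRestrictionMarkov
import Literature.Probability.RandomPlanarGeometry.CurveClassStopAtMeasurable
import Summits.CriticalPhenomena.SAWScalingLimit.Theorems.SAWRestrictionRigidityAxiomsOfLimitKernelClauseRangeSplit
import Summits.CriticalPhenomena.SAWScalingLimit.Theorems.SAWRestrictionRigidityAxiomsOfLimitKernelClauseMarkovLintegral
import Summits.CriticalPhenomena.SAWScalingLimit.Theorems.SAWRestrictionRigidityAxiomsOfLimitKernelClauseRestrictionLintegral
import Summits.CriticalPhenomena.SAWScalingLimit.Theorems.SAWRestrictionRigidityAxiomsOfLimitKernelClauseRelativeRestriction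
import HarnessLib

/-!
# Relative restriction a.e., for Markov kernels that are only a.e. equal to measurable functions

Crux `AxiomsOfLimit` (stmt-CriticalPhenomena-1370), line `registered`, stub
`stub_relativeRestrictionAE_aem` (lead c5, wave 2). Theorems only.

This is the "AEM" variant of `stub_relativeRestrictionAE`: instead of measurability of the
kernels `p ↦ Q D p T` we only assume that for every Dobrushin domain `D`, closed `F` and Borel
`T` there is a measurable `φ` with `Q D (γ.stopAt F) T = φ (γ.stopAt F)` for `P D`-a.e. `γ`.
Let `P` be chordal with the two-sided restriction property (i), `Q` a domain-Markov extension of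
`P` with this property, `E ⊆ D` nested Dobrushin domains with the same marked points, `F` closed,
`T` Borel, `R = {γ ⊆ closure E}`, `g = stopAt F`, `f = startFrom F`. Then for `P D`-a.e. `γ`
with `g γ ∈ R`: `Q E (g γ) T · Q D (g γ) R = Q D (g γ) (T ∩ R)`.

Proof. Pick measurable `φ_R, φ_TR` (`P D`-a.e. versions of `Q D (g ·) R`, `Q D (g ·) (T ∩ R)`)
and `φ_E` (a `P E`-a.e. version of `Q E (g ·) T`). (1) Exactly as in the measurable case
(restriction (i) in functional form, the range split `R = g⁻¹ R ∩ f⁻¹ R`, and the `markov`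
clause as an equality of push-forwards, which needs no kernel measurability), for every Borel
`S` both `∫_{g ∈ S ∩ R} φ_E (g) φ_R (g) dP D` and `∫_{g ∈ S ∩ R} φ_TR (g) dP D` equal
`P E (g ∈ S, f ∈ T) · P D R`; hence `φ_E φ_R = φ_TR` a.e. for the image of `P D` under `g`
restricted to `R`. (2) Where `Q D (g γ) R = 0` the claim is `0 = 0` by monotonicity. (3) Where
`φ_R (g γ) ≠ 0` we must know `Q E (g γ) T = φ_E (g γ)`; this holds `P E`-a.e., hence (by (i))
`P D`-a.e. on `R = {g ∈ R} ∩ {f ∈ R}`, and it is transferred to `P D`-a.e. on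
`{g ∈ R} ∩ {φ_R (g) ≠ 0}` by disintegrating `P D` along `g` (the curve space is standard Borel):
if `κ` is a conditional kernel of `γ` given `g γ`, then a.e. in `p`, `κ_p` is carried by the fibre
`{g = p}`, `κ_p {f ∈ R} = φ_R p`, and `κ_p M = 0` for the `P D`-null Borel set `M ⊇` (bad set)
`∩ {f ∈ R}`; since the bad set is `g`-saturated, for a bad `p` the fibre part of `{f ∈ R}` lies
in `M`, forcing `φ_R p = 0`.

References: G. F. Lawler, O. Schramm, W. Werner, *Conformal restriction: the chordal case* (2003)
§1, §3; W. Werner, *Lectures on two-dimensional critical percolation* (2007) §3.2 (2);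
O. Kallenberg, *Foundations of modern probability* (3rd ed., 2021) Thm. 8.5 (disintegration).
All [folklore].
-/

noncomputable section

open MeasureTheory ProbabilityTheory Set Filter
open scoped ENNReal

namespace Summit.CriticalPhenomena.SAWScalingLimit.Theorems.AxiomsOfLimitKernelClause

open Literature.Probability.RandomPlanarGeometry

namespace RelResAEM

/-! ### A null-set transfer along a measurable map, by disintegration -/

/-- **Saturated null sets transfer along a disintegration.** Let `μ` be a finite measure on a
standard Borel space `X`, `g : X → Y` measurable, `V ⊆ X` Borel, and `φ` a measurable version of
the conditional probability of `V` given `g`: `μ (g⁻¹ S ∩ V) = ∫_{g⁻¹ S} φ (g x) dμ` for every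
Borel `S`. If `B ⊆ Y` is ANY set such that `g⁻¹ B ∩ V` is contained in a `μ`-null Borel set `M`,
then for `μ`-a.e. `x` with `φ (g x) ≠ 0` we have `g x ∉ B`. (Disintegrate the law of `(g x, x)`:
a.e. in `p` the conditional kernel `κ_p` is carried by `{g = p}`, `κ_p V = φ p` and `κ_p M = 0`;
for `p ∈ B` the fibre part of `V` lies in `M`, so `φ p = 0`.) [folklore] -/
theorem ae_not_mem_of_null_saturated {X Y : Type*} [MeasurableSpace X] [MeasurableSpace Y]
    [StandardBorelSpace X] [Nonempty X] [MeasurableEq Y]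
    {μ : Measure X} [IsFiniteMeasure μ] {g : X → Y} (hg : Measurable g)
    {V : Set X} (hV : MeasurableSet V) {φ : Y → ℝ≥0∞} (hφ : Measurable φ)
    (hmk : ∀ S : Set Y, MeasurableSet S → μ (g ⁻¹' S ∩ V) = ∫⁻ x in g ⁻¹' S, φ (g x) ∂μ)
    {B : Set Y} {M : Set X} (hM : MeasurableSet M) (hμM : μ M = 0) (hBM : g ⁻¹' B ∩ V ⊆ M) :
    ∀ᵐ x ∂μ, φ (g x) ≠ 0 → g x ∉ B := by
  have hmeas : Measurable fun x => (g x, x) := hg.prodMk measurable_id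
  -- the joint law of `(g x, x)` and a conditional kernel of `x` given `g x`
  obtain ⟨Λ, hΛ⟩ : ∃ Λ : Measure (Y × X), Λ = μ.map (fun x => (g x, x)) := ⟨_, rfl⟩
  haveI : IsFiniteMeasure Λ := by
    rw [hΛ]
    infer_instance
  have hfst : Λ.fst = μ.map g := by
    rw [hΛ]
    exact Measure.fst_map_prodMk measurable_id
  set κ := Λ.condKernel
  have hdis : Λ.fst ⊗ₘ κ = Λ := Λ.disintegrate κ
  -- the disintegration on product sets
  have hprod : ∀ (S : Set Y) (M' : Set X), MeasurableSet S → MeasurableSet M' →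
      ∫⁻ p in S, κ p M' ∂(μ.map g) = μ (g ⁻¹' S ∩ M') := by
    intro S M' hS hM'
    rw [← hfst, ← Measure.compProd_apply_prod hS hM', hdis, hΛ,
      Measure.map_apply hmeas (hS.prod hM')]
    rfl
  -- a.e. in `p`, the conditional kernel is carried by the fibre `{g = p}`
  have hdiag : MeasurableSet {q : Y × X | g q.2 = q.1} :=
    measurableSet_eq_fun (hg.comp measurable_snd) measurable_fst
  have hsupp : ∀ᵐ p ∂(μ.map g), κ p {x | g x ≠ p} = 0 := by
    have h0 : Λ {q : Y × X | g q.2 = q.1}ᶜ = 0 := by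
      have he : (fun x => (g x, x)) ⁻¹' {q : Y × X | g q.2 = q.1}ᶜ = ∅ := by
        ext x
        simp
      rw [hΛ, Measure.map_apply hmeas hdiag.compl, he, measure_empty]
    rw [← hdis, Measure.compProd_apply hdiag.compl, hfst,
      lintegral_eq_zero_iff (Kernel.measurable_kernel_prodMk_left hdiag.compl)] at h0
    filter_upwards [h0] with p hp
    exact hp
  -- a.e. in `p`, `φ p` is the conditional probability of `V`
  have hφκ : φ =ᵐ[μ.map g] fun p => κ p V := by
    refine ae_eq_of_forall_setLIntegral_eq_of_sigmaFinite hφ (Kernel.measurable_coe κ hV)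
      fun S hS _ => ?_
    rw [setLIntegral_map hS hφ hg, hprod S V hS hV, hmk S hS]
  -- a.e. in `p`, the null set `M` is conditionally null
  have hκM : ∀ᵐ p ∂(μ.map g), κ p M = 0 := by
    have h0 : ∫⁻ p, κ p M ∂(μ.map g) = 0 := by
      have h := hprod Set.univ M MeasurableSet.univ hM
      rwa [Measure.restrict_univ, Set.preimage_univ, Set.univ_inter, hμM] at h
    filter_upwards [(lintegral_eq_zero_iff (Kernel.measurable_coe κ hM)).1 h0] with p hp
    exact hp
  -- combine: for a bad `p`, the fibre part of `V` lies in `M`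
  have key : ∀ᵐ p ∂(μ.map g), φ p ≠ 0 → p ∉ B := by
    filter_upwards [hsupp, hφκ, hκM] with p h1 h2 h3 hφp hpB
    apply hφp
    rw [h2]
    refine le_antisymm ?_ (zero_le)
    calc κ p V ≤ κ p ({x | g x ≠ p} ∪ M) := measure_mono fun x hx => ?_
      _ ≤ κ p {x | g x ≠ p} + κ p M := measure_union_le _ _
      _ = 0 := by rw [h1, h3, add_zero]
    by_cases hx' : g x = p
    · refine Or.inr (hBM ⟨?_, hx⟩)
      rw [Set.mem_preimage, hx']
      exact hpB
    · exact Or.inl hx'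
  exact ae_of_ae_map hg.aemeasurable key

/-! ### The `markov` clause in functional form, with an a.e. measurable version of the kernel -/

/-- **The `markov` clause in functional form, a.e. version of the kernel.** If `Q` is a Markov
extension of `P`, `F` is closed, `T` is Borel and `φ` is measurable with
`Q D (γ.stopAt F) T = φ (γ.stopAt F)` for `P D`-a.e. `γ`, then for every measurable `h`,
`∫⁻ γ in startFrom F ⁻¹' T, h (γ.stopAt F) ∂(P D) = ∫⁻ γ, h (γ.stopAt F) * φ (γ.stopAt F) ∂(P D)`:
both sides are the integral of `h` against the common push-forward of
`MarkovLintegral.map_restrict_eq_map_withDensity`, after swapping the density for `φ ∘ stopAt F`.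
[folklore] -/
theorem markov_lintegral_ae {P : ChordalFamily}
    {Q : DobrushinDomain → CurveClass ℂ → Measure (CurveClass ℂ)} (hQ : P.IsMarkovExtension Q)
    (D : DobrushinDomain) {F : Set ℂ} (hF : IsClosed F) {T : Set (CurveClass ℂ)}
    (hT : MeasurableSet T) {φ : CurveClass ℂ → ℝ≥0∞} (hφm : Measurable φ)
    (hφ : ∀ᵐ γ ∂P D, Q D (γ.stopAt F) T = φ (γ.stopAt F)) {h : CurveClass ℂ → ℝ≥0∞}
    (hh : Measurable h) :
    ∫⁻ γ in CurveClass.startFrom F ⁻¹' T, h (γ.stopAt F) ∂P D =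
      ∫⁻ γ, h (γ.stopAt F) * φ (γ.stopAt F) ∂P D := by
  have hg : Measurable (CurveClass.stopAt F : CurveClass ℂ → CurveClass ℂ) :=
    CurveClass.measurable_stopAt hF
  have hd : Measurable fun γ : CurveClass ℂ => φ (γ.stopAt F) := hφm.comp hg
  have hhg : Measurable fun γ : CurveClass ℂ => h (γ.stopAt F) := hh.comp hg
  have key := MarkovLintegral.map_restrict_eq_map_withDensity hQ D hF hT
  rw [withDensity_congr_ae hφ] at key
  have key2 : ∫⁻ p, h p ∂((P D).restrict (CurveClass.startFrom F ⁻¹' T)).map (CurveClass.stopAt F) =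
      ∫⁻ p, h p ∂((P D).withDensity fun γ => φ (γ.stopAt F)).map (CurveClass.stopAt F) := by
    rw [key]
  rw [lintegral_map hh hg, lintegral_map hh hg,
    lintegral_withDensity_eq_lintegral_mul _ hd hhg] at key2
  rw [key2]
  refine lintegral_congr fun γ => ?_
  rw [Pi.mul_apply, mul_comm]

/-! ### The relative restriction identity, almost everywhere (AEM kernels) -/

/-- **Relative restriction, a.e., for a.e.-measurable kernels.** Let `P` be chordal with the
two-sided restriction property, `Q` a Markov extension of `P` such that every `Q D (stopAt F ·) T`
agrees `P D`-a.e. with a measurable function of `stopAt F`, `E ⊆ D` nested Dobrushin domains with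
the same marked points, `F` closed and `T` Borel; write `R = {⊆ closure E}`. Then for `P D`-a.e.
`γ`, if `γ.stopAt F ∈ R` then `Q E (γ.stopAt F) T · Q D (γ.stopAt F) R = Q D (γ.stopAt F) (T ∩ R)`.
See the module docstring for the proof. [folklore] -/
theorem relativeRestriction_ae {P : ChordalFamily} (hch : P.IsChordal)
    (hR : P.IsRestriction) {Q : DobrushinDomain → CurveClass ℂ → Measure (CurveClass ℂ)}
    (hQ : P.IsMarkovExtension Q)
    (hQm : ∀ (D : DobrushinDomain) (F : Set ℂ), IsClosed F → ∀ T : Set (CurveClass ℂ),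
      MeasurableSet T → ∃ φ : CurveClass ℂ → ℝ≥0∞, Measurable φ ∧
        ∀ᵐ γ ∂P D, Q D (γ.stopAt F) T = φ (γ.stopAt F))
    {D E : DobrushinDomain} (hsub : E.carrier ⊆ D.carrier) (h0 : E.pt 0 = D.pt 0)
    (h1 : E.pt 1 = D.pt 1) {F : Set ℂ} (hF : IsClosed F) {T : Set (CurveClass ℂ)}
    (hT : MeasurableSet T) :
    ∀ᵐ γ ∂P D, γ.stopAt F ∈ CurveClass.rangeSubset (closure E.carrier) →
      Q E (γ.stopAt F) T * Q D (γ.stopAt F) (CurveClass.rangeSubset (closure E.carrier)) =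
        Q D (γ.stopAt F) (T ∩ CurveClass.rangeSubset (closure E.carrier)) := by
  set R := CurveClass.rangeSubset (closure E.carrier)
  have hRm : MeasurableSet R := CurveClass.measurableSet_rangeSubset isClosed_closure
  have hg : Measurable (CurveClass.stopAt F : CurveClass ℂ → CurveClass ℂ) :=
    CurveClass.measurable_stopAt hF
  have hf : Measurable (CurveClass.startFrom F : CurveClass ℂ → CurveClass ℂ) :=
    CurveClass.measurable_startFrom hF
  haveI : IsProbabilityMeasure (P D) := (hch D).1
  -- (C): staying in `closure E` splits along (past, future)
  have hsplit : ∀ c : CurveClass ℂ, c ∈ R ↔ c.stopAt F ∈ R ∧ c.startFrom F ∈ R := fun c =>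
    stub_rangeSubset_iff_stopAt_startFrom F (closure E.carrier) c
  -- measurable a.e. versions of the three kernel values
  obtain ⟨φR, hφRm, hφR⟩ := hQm D F hF R hRm
  obtain ⟨φTR, hφTRm, hφTR⟩ := hQm D F hF (T ∩ R) (hT.inter hRm)
  obtain ⟨φE, hφEm, hφE⟩ := hQm E F hF T hT
  -- (1) the identity between the versions, integrated against every Borel set of pasts
  have key : ∀ S : Set (CurveClass ℂ), MeasurableSet S →
      ∫⁻ γ in CurveClass.stopAt F ⁻¹' (S ∩ R), φE (γ.stopAt F) * φR (γ.stopAt F) ∂P D =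
        ∫⁻ γ in CurveClass.stopAt F ⁻¹' (S ∩ R), φTR (γ.stopAt F) ∂P D := by
    intro S hS
    have hSR : MeasurableSet (S ∩ R) := hS.inter hRm
    -- the `D`-side: restriction (i), (C), Markov at `D`
    have hDside : P E (CurveClass.stopAt F ⁻¹' S ∩ CurveClass.startFrom F ⁻¹' T) * P D R =
        ∫⁻ γ in CurveClass.stopAt F ⁻¹' (S ∩ R), φTR (γ.stopAt F) ∂P D := by
      rw [hR D E hsub h0 h1 _ ((hS.preimage hg).inter (hT.preimage hf))]
      have hset : CurveClass.stopAt F ⁻¹' S ∩ CurveClass.startFrom F ⁻¹' T ∩ R =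
          CurveClass.stopAt F ⁻¹' (S ∩ R) ∩ CurveClass.startFrom F ⁻¹' (T ∩ R) := by
        ext c
        simp only [Set.mem_inter_iff, Set.mem_preimage]
        rw [hsplit c]
        tauto
      rw [hset, hQ.markov D F hF (S ∩ R) (T ∩ R) hSR (hT.inter hRm)]
      exact lintegral_congr_ae (ae_restrict_of_ae hφTR)
    -- the `E`-side: Markov at `E`, (A), (C), Markov at `D` in functional form
    have hEside : P E (CurveClass.stopAt F ⁻¹' S ∩ CurveClass.startFrom F ⁻¹' T) * P D R =
        ∫⁻ γ in CurveClass.stopAt F ⁻¹' (S ∩ R), φE (γ.stopAt F) * φR (γ.stopAt F) ∂P D := by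
      -- Markov at `E`, as an integral of an indicator of the measurable version
      have e1 : P E (CurveClass.stopAt F ⁻¹' S ∩ CurveClass.startFrom F ⁻¹' T) =
          ∫⁻ γ, S.indicator φE (γ.stopAt F) ∂P E := by
        rw [hQ.markov E F hF S T hS hT,
          lintegral_congr_ae (ae_restrict_of_ae (s := CurveClass.stopAt F ⁻¹' S) hφE),
          ← lintegral_indicator (hS.preimage hg)]
        rfl
      -- (A): transfer to `P D` restricted to `R`
      have e2 := stub_restriction_lintegral P hR D E hsub h0 h1
        (fun γ => S.indicator φE (γ.stopAt F)) ((hφEm.indicator hS).comp hg)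
      -- (C): on `R` the past and the future stay in `closure E`
      have e3 : ∫⁻ γ in R, S.indicator φE (γ.stopAt F) ∂P D =
          ∫⁻ γ in CurveClass.startFrom F ⁻¹' R,
            (S ∩ R).indicator φE (γ.stopAt F) ∂P D := by
        rw [← lintegral_indicator hRm, ← lintegral_indicator (hRm.preimage hf)]
        refine lintegral_congr fun γ => ?_
        by_cases hγ : γ ∈ R
        · have hγ' := (hsplit γ).1 hγ
          rw [Set.indicator_of_mem hγ, Set.indicator_of_mem (show γ ∈ _ from hγ'.2)]
          by_cases hS' : γ.stopAt F ∈ S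
          · rw [Set.indicator_of_mem hS', Set.indicator_of_mem (Set.mem_inter hS' hγ'.1)]
          · rw [Set.indicator_of_notMem hS',
              Set.indicator_of_notMem fun h => hS' (Set.mem_of_mem_inter_left h)]
        · rw [Set.indicator_of_notMem hγ]
          by_cases hfut : γ ∈ CurveClass.startFrom F ⁻¹' R
          · rw [Set.indicator_of_mem hfut, Set.indicator_of_notMem]
            exact fun h => hγ ((hsplit γ).2 ⟨Set.mem_of_mem_inter_right h, hfut⟩)
          · rw [Set.indicator_of_notMem hfut]
      -- (B): Markov at `D` in functional form with `T' = R` and the version `φR`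
      have e4 := markov_lintegral_ae hQ D hF hRm hφRm hφR (hφEm.indicator hSR)
      -- back to a set integral
      have e5 : ∫⁻ γ, (S ∩ R).indicator φE (γ.stopAt F) * φR (γ.stopAt F) ∂P D =
          ∫⁻ γ in CurveClass.stopAt F ⁻¹' (S ∩ R), φE (γ.stopAt F) * φR (γ.stopAt F) ∂P D := by
        rw [← lintegral_indicator (hSR.preimage hg)]
        refine lintegral_congr fun γ => ?_
        by_cases hγ : γ.stopAt F ∈ S ∩ R
        · rw [Set.indicator_of_mem hγ, Set.indicator_of_mem (show γ ∈ _ from hγ)]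
        · rw [Set.indicator_of_notMem hγ, Set.indicator_of_notMem (show γ ∉ _ from hγ),
            zero_mul]
      rw [e1, e2, e3, e4, e5]
    rw [← hEside, hDside]
  -- from the integrated identity to the a.e. identity of the versions, through the image measure
  have hφ₁ : Measurable fun p : CurveClass ℂ => φE p * φR p := hφEm.mul hφRm
  have hae : ∀ᵐ p ∂((P D).map (CurveClass.stopAt F)).restrict R, φE p * φR p = φTR p := by
    refine ae_eq_of_forall_setLIntegral_eq_of_sigmaFinite (μ := ((P D).map
      (CurveClass.stopAt F)).restrict R) hφ₁ hφTRm fun S hS _ => ?_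
    rw [Measure.restrict_restrict hS, setLIntegral_map (hS.inter hRm) hφ₁ hg,
      setLIntegral_map (hS.inter hRm) hφTRm hg]
    exact key S hS
  rw [ae_restrict_iff' hRm] at hae
  have h2 := ae_of_ae_map hg.aemeasurable hae
  -- (3) the version `φE` is `Q E (stopAt F ·) T`, `P D`-a.e. on `R` ...
  have h3a : ∀ᵐ γ ∂(P D).restrict R, Q E (γ.stopAt F) T = φE (γ.stopAt F) := by
    rw [← RestrictionLintegral.smul_eq_restrict_of_forall fun T' hT' => hR D E hsub h0 h1 T' hT']
    exact Measure.ae_smul_measure hφE _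
  rw [ae_restrict_iff' hRm] at h3a
  -- ... and, by disintegration along `stopAt F`, `P D`-a.e. where `φR (stopAt F) ≠ 0`
  have h3 : ∀ᵐ γ ∂P D, φR (γ.stopAt F) ≠ 0 →
      γ.stopAt F ∉ {p | p ∈ R ∧ Q E p T ≠ φE p} := by
    haveI : Nonempty (CurveClass ℂ) := ⟨CurveClass.mk (Curve.const 0)⟩
    refine ae_not_mem_of_null_saturated hg (hRm.preimage hf) hφRm (fun S hS => ?_)
      (measurableSet_toMeasurable (P D)
        {γ | ¬(γ ∈ R → Q E (γ.stopAt F) T = φE (γ.stopAt F))})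
      ((measure_toMeasurable _).trans (ae_iff.1 h3a)) ?_
    · rw [hQ.markov D F hF S R hS hRm]
      exact lintegral_congr_ae (ae_restrict_of_ae hφR)
    · rintro γ ⟨⟨hγR, hγne⟩, hγf⟩
      exact subset_toMeasurable _ _ fun himp => hγne (himp ((hsplit γ).2 ⟨hγR, hγf⟩))
  -- conclusion
  filter_upwards [hφR, hφTR, h2, h3] with γ hγR hγTR hγ2 hγ3 hgR
  by_cases hz : Q D (γ.stopAt F) R = 0
  · rw [hz, mul_zero]
    exact (measure_mono_null Set.inter_subset_right hz).symm
  · have hne : φR (γ.stopAt F) ≠ 0 := fun h => hz (hγR.trans h)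
    have hQE : Q E (γ.stopAt F) T = φE (γ.stopAt F) := by
      by_contra hc
      exact hγ3 hne ⟨hgR, hc⟩
    rw [hQE, hγR, hγTR]
    exact hγ2 hgR

end RelResAEM

/-! ### Registered sub-goal of crux stmt-CriticalPhenomena-1370 (line `registered`, stub `stub_relativeRestrictionAE_aem`) -/

/-- **Registered sub-goal `stub_relativeRestrictionAE_aem`** (crux stmt-CriticalPhenomena-1370,
lead c5, wave 2): the relative restriction identity for Markov kernels that are only a.e. equal
to measurable functions of the past, `RelResAEM.relativeRestriction_ae`, notation-free.
[folklore] -/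
theorem stub_relativeRestrictionAE_aem : ∀ (P : Literature.Probability.RandomPlanarGeometry.ChordalFamily), P.IsChordal → P.IsRestriction → ∀ (Q : Literature.Probability.RandomPlanarGeometry.DobrushinDomain → Literature.Probability.RandomPlanarGeometry.CurveClass ℂ → MeasureTheory.Measure (Literature.Probability.RandomPlanarGeometry.CurveClass ℂ)), P.IsMarkovExtension Q → (∀ (D : Literature.Probability.RandomPlanarGeometry.DobrushinDomain) (F : Set ℂ), IsClosed F → ∀ T : Set (Literature.Probability.RandomPlanarGeometry.CurveClass ℂ), MeasurableSet T → ∃ φ : Literature.Probability.RandomPlanarGeometry.CurveClass ℂ → ENNReal, Measurable φ ∧ Filter.Eventually (fun γ : Literature.Probability.RandomPlanarGeometry.CurveClass ℂ => Q D (γ.stopAt F) T = φ (γ.stopAt F)) (MeasureTheory.ae (P D))) → ∀ (D E : Literature.Probability.RandomPlanarGeometry.DobrushinDomain), E.carrier ⊆ D.carrier → E.pt 0 = D.pt 0 → E.pt 1 = D.pt 1 → ∀ (F : Set ℂ), IsClosed F → ∀ (T : Set (Literature.Probability.RandomPlanarGeometry.CurveClass ℂ)), MeasurableSet T → Filter.Eventually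 (fun γ : Literature.Probability.RandomPlanarGeometry.CurveClass ℂ => γ.stopAt F ∈ Literature.Probability.RandomPlanarGeometry.CurveClass.rangeSubset (closure E.carrier) → Q E (γ.stopAt F) T * Q D (γ.stopAt F) (Literature.Probability.RandomPlanarGeometry.CurveClass.rangeSubset (closure E.carrier)) = Q D (γ.stopAt F) (T ∩ Literature.Probability.RandomPlanarGeometry.CurveClass.rangeSubset (closure E.carrier))) (MeasureTheory.ae (P D)) :=
  fun _P hch hR _Q hQ hQm _D _E hsub h0 h1 _F hF _T hT =>
    RelResAEM.relativeRestriction_ae hch hR hQ hQm hsub h0 h1 hF hT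

end Summit.CriticalPhenomena.SAWScalingLimit.Theorems.AxiomsOfLimitKernelClause

end
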